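import Literature.Topology.FourManifolds.ProductNeighborhoodNormalForm
import HarnessLib

/-!
# Straightening a map to `ℝᵇ` at an interior point with onto differential

Topic `Literature/Topology/FourManifolds` (the local form of submersions in codimension `m`,
generalising the codimension-one `Literature.Topology.FourManifolds.exists_sliceChart` of `RegularLevelSet.lean`; fact seat
`provefact-Literature.Geometry.Symplectic.Oba2016_s-add47373d4`, where the fibres
`f⁻¹(c) ∩ Int W` of a Lefschetz fibration `f : W → ℝ²` over the disc and `f`-adapted charts of
`W` about their points are needed for the Morse theory of functions of the form `A ∘ f + B`).
Everything is proved; no definitions (the coordinate splitting is the tree's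
`Literature.Topology.FourManifolds.appendCLE`, `ProductNeighborhoodNormalForm.lean`).

Hirsch, *Differential Topology* (1976), Ch. 1 §3, Thm. 3.2 and its proof (*"the theorem follows
from the inverse function theorem"*): about a point where `df` is onto, `f` is, in suitable
charts, the projection to the last `m` coordinates up to translation.  Here:

* §1 `appendCLE_zero_mem_interior_range_euclidean`, `appendCLE_single_zero_mem_interior_range`
  — base points `appendCLE hab (c, 0)` interior to the models `𝓡 N` and `𝓡∂ N` (`a ≥ 1`);
* §2 `exists_continuousLinearEquiv_snd_eq_of_surjective` — an onto linear map `L : ℝᴺ → ℝᵇ`,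
  `a + b = N`, is the second component of a linear isomorphism `T : ℝᴺ ≅ ℝᵃ × ℝᵇ` (complete a
  basis of `ker L ≅ ℝᵃ`);
* §3 `exists_straighteningChart` — **straightening**: for `f : M → ℝᵇ` smooth on a manifold
  modelled on a model with corners `I` on `ℝᴺ`, `a + b = N`, an interior point `z` with `df_z`
  onto, and a vector `c ∈ ℝᵃ` with `appendCLE hab (c, 0)` in the interior of the model, there is
  a chart `ψ` of the maximal `C^∞` atlas about `z`, valued in the interior of the model, with
  `I (ψ z) = appendCLE hab (c, 0)` and whose last `b` coordinates are `f - f z`: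
  `((appendCLE hab)⁻¹ (I (ψ q))).2 = f q - f z` on `ψ.source` (inverse function theorem for
  `Θ y = appendCLE hab (π₁ (T y) - π₁ (T y₀) + c, f φ⁻¹ y - f z)`, conjugated into the model by
  `OpenPartialHomeomorph.conjModel`).

## References

* M. W. Hirsch, *Differential Topology*, GTM 33, Springer (1976), Ch. 1 §3, Thms. 3.1–3.2
  (pp. 21–23). [HirschDT1976]
* J. M. Lee, *Introduction to Smooth Manifolds*, 2nd ed., GTM 218 (2013), Thm. 4.12 (rank
  theorem), Cor. 5.14. [LeeSmoothManifolds2013]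
-/

open scoped Manifold ContDiff Topology
open Set Function Module

noncomputable section

namespace Literature.Topology.FourManifolds

/-! ### §1 Base points in the interior of the models -/

section Append

variable {a b N : ℕ} (hab : a + b = N)

/-- For `a ≥ 1`, the `0`-th coordinate of `appendCLE hab (u, v)` is `u 0`. [folklore] -/
theorem appendCLE_apply_zero [NeZero a] [NeZero N] (p : EuclideanSpace ℝ (Fin a) × EuclideanSpace ℝ (Fin b)) :
    appendCLE hab p 0 = p.1 0 :=
  appendCLE_apply_of_lt hab p 0 (NeZero.pos a)

/-- For the boundaryless model `𝓡 N` every `appendCLE hab (c, 0)` is in the interior of the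
model. [folklore] -/
theorem appendCLE_zero_mem_interior_range_euclidean (c : EuclideanSpace ℝ (Fin a)) :
    appendCLE hab (c, 0) ∈ interior (range (𝓡 N)) := by
  simp

/-- For the half-space model `𝓡∂ N`, `a ≥ 1`, the point `appendCLE hab (e₀, 0)`,
`e₀ = (1, 0, …, 0) ∈ ℝᵃ`, is in the interior `{y | 0 < y 0}` of the model. [folklore] -/
theorem appendCLE_single_zero_mem_interior_range [NeZero a] [NeZero N] :
    appendCLE hab (EuclideanSpace.single (0 : Fin a) (1 : ℝ), 0) ∈ interior (range (𝓡∂ N)) := by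
  rw [interior_range_modelWithCornersEuclideanHalfSpace]
  show (0 : ℝ) < appendCLE hab (EuclideanSpace.single (0 : Fin a) (1 : ℝ), 0) 0
  rw [appendCLE_apply_zero]
  simp

end Append

/-! ### §2 Linear algebra: an onto linear map to `ℝᵐ` is a coordinate block -/

/-- An onto linear map `L : ℝᴺ → ℝᵇ`, `a + b = N`, is the second component of a linear
isomorphism `T : ℝᴺ ≅ ℝᵃ × ℝᵇ`, i.e. `(T y).2 = L y` (complete a basis of `ker L ≅ ℝᵃ` by a
retraction onto the kernel; the codimension-one case is the tree's
`Literature.Topology.FourManifolds.exists_continuousLinearEquiv_snd_eq`). [folklore] -/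
theorem exists_continuousLinearEquiv_snd_eq_of_surjective {a b N : ℕ} (hab : a + b = N)
    (L : EuclideanSpace ℝ (Fin N) →L[ℝ] EuclideanSpace ℝ (Fin b)) (hL : Surjective L) :
    ∃ T : EuclideanSpace ℝ (Fin N) ≃L[ℝ] (EuclideanSpace ℝ (Fin a) × EuclideanSpace ℝ (Fin b)), ∀ y, (T y).2 = L y := by
  have hrange : LinearMap.range (L : EuclideanSpace ℝ (Fin N) →ₗ[ℝ] EuclideanSpace ℝ (Fin b)) = ⊤ :=
    LinearMap.range_eq_top.2 hL
  -- the kernel has dimension `a`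
  have hfinK : finrank ℝ (LinearMap.ker (L : EuclideanSpace ℝ (Fin N) →ₗ[ℝ] EuclideanSpace ℝ (Fin b))) = a := by
    have h := LinearMap.finrank_range_add_finrank_ker (L : EuclideanSpace ℝ (Fin N) →ₗ[ℝ] EuclideanSpace ℝ (Fin b))
    rw [hrange, finrank_top, finrank_euclideanSpace_fin, finrank_euclideanSpace_fin] at h
    omega
  set K : Submodule ℝ (EuclideanSpace ℝ (Fin N)) := LinearMap.ker (L : EuclideanSpace ℝ (Fin N) →ₗ[ℝ] EuclideanSpace ℝ (Fin b)) with hK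
  let e : K ≃ₗ[ℝ] EuclideanSpace ℝ (Fin a) := LinearEquiv.ofFinrankEq K (EuclideanSpace ℝ (Fin a)) (by rw [hfinK, finrank_euclideanSpace_fin])
  obtain ⟨g, hg⟩ := LinearMap.exists_leftInverse_of_injective K.subtype (by
    rw [Submodule.ker_subtype])
  let T₀ : EuclideanSpace ℝ (Fin N) →ₗ[ℝ] (EuclideanSpace ℝ (Fin a) × EuclideanSpace ℝ (Fin b)) := ((e : K →ₗ[ℝ] EuclideanSpace ℝ (Fin a)) ∘ₗ g).prod (L : EuclideanSpace ℝ (Fin N) →ₗ[ℝ] EuclideanSpace ℝ (Fin b))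
  have hT₀ : Injective T₀ := by
    rw [← LinearMap.ker_eq_bot, LinearMap.ker_eq_bot']
    intro y hy
    have hy2 : L y = 0 := congrArg Prod.snd hy
    have hy1 : e (g y) = 0 := congrArg Prod.fst hy
    have hyK : y ∈ K := hy2
    have hgy : g y = ⟨y, hyK⟩ := by
      simpa using LinearMap.congr_fun hg ⟨y, hyK⟩
    rw [hgy, LinearEquiv.map_eq_zero_iff] at hy1
    exact congrArg Subtype.val hy1
  have hdim : finrank ℝ (EuclideanSpace ℝ (Fin N)) = finrank ℝ (EuclideanSpace ℝ (Fin a) × EuclideanSpace ℝ (Fin b)) := by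
    simp [finrank_prod, hab]
  exact ⟨(LinearMap.linearEquivOfInjective T₀ hT₀ hdim).toContinuousLinearEquiv, fun y => rfl⟩

/-! ### §3 Straightening at an interior point with onto differential -/

section Straightening

universe u

variable {a b N : ℕ} {H : Type*} [TopologicalSpace H] {I : ModelWithCorners ℝ (EuclideanSpace ℝ (Fin N)) H}
  {M : Type u} [TopologicalSpace M] [ChartedSpace H M] [IsManifold I ∞ M]

/-- **Straightening a smooth map to `ℝᵐ` at an interior point with onto differential**
(Hirsch 1976, Ch. 1 §3, proof of Thm. 3.2; Lee 2012, Thm. 4.12).  Let `f : M → ℝᵇ` be smooth on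
a `C^∞` manifold `M` modelled on a model with corners `I` on `ℝᴺ`, `a + b = N`, `z` an interior
point at which `df_z` is onto, and `c ∈ ℝᵃ` a vector with `appendCLE hab (c, 0)` interior to the
model.  Then there is a chart `ψ` of the maximal `C^∞` atlas of `M` about `z`, valued in the
interior of the model, with `I (ψ z) = appendCLE hab (c, 0)` and whose last `b` coordinates are
`f - f z`: `((appendCLE hab)⁻¹ (I (ψ q))).2 = f q - f z` on `ψ.source`.  Proof: in the chart `φ`
at `z` write `g = f ∘ φ⁻¹`, pick `T : ℝᴺ ≅ ℝᵃ × ℝᵇ` with second component `dg(φ z)`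
(`exists_continuousLinearEquiv_snd_eq_of_surjective`); the map
`Θ y = appendCLE hab (π₁ (T y) - π₁ (T (φ z)) + c, g y - f z)` has derivative `appendCLE ∘ T`
at `φ z`, hence is a local diffeomorphism there, and `ψ = (I⁻¹ Θ I) ∘ φ`.
[cite: HirschDT1976, Ch. 1 §3, Thm. 3.2 (proof)] -/
theorem exists_straighteningChart (hab : a + b = N) {f : M → EuclideanSpace ℝ (Fin b)}
    (hf : ContMDiff I 𝓘(ℝ, EuclideanSpace ℝ (Fin b)) ∞ f) {z : M}
    (hz : I.IsInteriorPoint z) (hsurj : Surjective (mfderiv I 𝓘(ℝ, EuclideanSpace ℝ (Fin b)) f z))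
    (c : EuclideanSpace ℝ (Fin a)) (hc : appendCLE hab (c, 0) ∈ interior (range I)) :
    ∃ ψ : OpenPartialHomeomorph M H, ψ ∈ IsManifold.maximalAtlas I ∞ M ∧ z ∈ ψ.source ∧
      I (ψ z) = appendCLE hab (c, 0) ∧
      (∀ q ∈ ψ.source, ((appendCLE hab).symm (I (ψ q))).2 = f q - f z) ∧
      ∀ q ∈ ψ.source, I (ψ q) ∈ interior (range I) := by
  -- the chart at `z`, and `f` read in it
  set φ := chartAt H z with hφ
  set y₀ : EuclideanSpace ℝ (Fin N) := extChartAt I z z with hy₀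
  have hy₀' : y₀ = I (φ z) := rfl
  set g : EuclideanSpace ℝ (Fin N) → EuclideanSpace ℝ (Fin b) := f ∘ (extChartAt I z).symm with hg
  set O : Set (EuclideanSpace ℝ (Fin N)) := I.symm ⁻¹' φ.target ∩ interior (range I) with hO
  have hOopen : IsOpen O := (φ.open_target.preimage I.continuous_symm).inter isOpen_interior
  have hy₀O : y₀ ∈ O := ⟨by rw [mem_preimage, hy₀', I.left_inv]; exact mem_chart_target H z, hz⟩
  have hOsub : O ⊆ (extChartAt I z).target := by
    rintro y ⟨hy, hy'⟩
    rw [extChartAt_target]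
    exact ⟨hy, interior_subset hy'⟩
  have hgO : ContDiffOn ℝ ∞ g O := by
    have h := (contMDiff_iff.1 hf).2 z (f z)
    refine (h.mono ?_).congr ?_
    · intro y hy
      refine ⟨hOsub hy, ?_⟩
      simp only [mem_preimage, extChartAt_source, chartAt_self_eq,
        OpenPartialHomeomorph.refl_source, mem_univ]
    · intro y _
      simp only [hg, comp_apply, extChartAt_self_apply, modelWithCornersSelf_coe, id_eq]
  -- the derivative `L` of `g` at `y₀` is `mfderiv f z`, onto
  have hmd : MDifferentiableAt I 𝓘(ℝ, EuclideanSpace ℝ (Fin b)) f z := (hf z).mdifferentiableAt (by simp)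
  have hw : writtenInExtChartAt I 𝓘(ℝ, EuclideanSpace ℝ (Fin b)) z f = g := by
    ext y
    simp [writtenInExtChartAt, hg]
  have hnhds : range I ∈ 𝓝 y₀ := Filter.mem_of_superset (isOpen_interior.mem_nhds hz) interior_subset
  set L : EuclideanSpace ℝ (Fin N) →L[ℝ] EuclideanSpace ℝ (Fin b) := fderiv ℝ g y₀ with hL
  have hLeq : mfderiv I 𝓘(ℝ, EuclideanSpace ℝ (Fin b)) f z = L := by
    rw [hmd.mfderiv, hw, fderivWithin_of_mem_nhds hnhds]
  have hL' : Surjective L := by rw [← hLeq]; exact hsurj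
  have hgderiv : HasFDerivAt g L y₀ :=
    ((hgO.contDiffAt (hOopen.mem_nhds hy₀O)).differentiableAt (by simp)).hasFDerivAt
  obtain ⟨T, hT⟩ := exists_continuousLinearEquiv_snd_eq_of_surjective hab L hL'
  -- the straightening map `Θ` and its derivative `appendCLE ∘ T` at `y₀`
  have hgy₀ : g y₀ = f z := by
    rw [hg, comp_apply, hy₀, extChartAt_to_inv]
  set Θ : EuclideanSpace ℝ (Fin N) → EuclideanSpace ℝ (Fin N) :=
    fun y => appendCLE hab ((T y).1 - (T y₀).1 + c, g y - f z) with hΘ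
  have hΘy₀ : Θ y₀ = appendCLE hab (c, 0) := by
    simp only [hΘ, sub_self, zero_add, hgy₀]
  have hΘO : ContDiffOn ℝ ∞ Θ O := by
    refine (appendCLE hab).contDiff.comp_contDiffOn (ContDiffOn.prodMk ?_ ?_)
    · exact ((contDiff_fst.comp T.contDiff).contDiffOn.sub contDiffOn_const).add
        contDiffOn_const
    · exact hgO.sub contDiffOn_const
  have hΘderiv : HasFDerivAt Θ
      ((T.trans (appendCLE hab) : EuclideanSpace ℝ (Fin N) ≃L[ℝ] EuclideanSpace ℝ (Fin N)) :
        EuclideanSpace ℝ (Fin N) →L[ℝ] EuclideanSpace ℝ (Fin N)) y₀ := by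
    have h1 : HasFDerivAt (fun y => (T y).1 - (T y₀).1 + c)
        ((ContinuousLinearMap.fst ℝ (EuclideanSpace ℝ (Fin a)) (EuclideanSpace ℝ (Fin b))).comp (T : EuclideanSpace ℝ (Fin N) →L[ℝ] EuclideanSpace ℝ (Fin a) × EuclideanSpace ℝ (Fin b))) y₀ :=
      (((ContinuousLinearMap.fst ℝ (EuclideanSpace ℝ (Fin a)) (EuclideanSpace ℝ (Fin b))).comp
        (T : EuclideanSpace ℝ (Fin N) →L[ℝ] EuclideanSpace ℝ (Fin a) × EuclideanSpace ℝ (Fin b))).hasFDerivAt.sub_const _).add_const _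
    have h2 : HasFDerivAt (fun y => g y - f z) L y₀ := hgderiv.sub_const _
    have h3 := (appendCLE hab).hasFDerivAt.comp y₀ (h1.prodMk h2)
    refine h3.congr_fderiv (ContinuousLinearMap.ext fun y => ?_)
    simp only [ContinuousLinearEquiv.coe_coe, ContinuousLinearEquiv.trans_apply,
      ContinuousLinearMap.coe_comp, comp_apply, ContinuousLinearMap.prod_apply,
      ContinuousLinearMap.coe_fst']
    rw [← hT y]
  -- the inverse function theorem
  obtain ⟨G, hGΘ, hy₀G, hGO, hGsm, hGsm'⟩ :=
    exists_openPartialHomeomorph_contDiffOn_symm hOopen hy₀O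
      (m := ∞) (by simp) hΘO (T.trans (appendCLE hab)) hΘderiv
  -- the chart `ψ = (I⁻¹ G I) ∘ φ`
  set K := G.conjModel I with hK
  have hKmem : K ∈ contDiffGroupoid ∞ I :=
    OpenPartialHomeomorph.conjModel_mem_contDiffGroupoid hGsm hGsm'
  have hzK : φ z ∈ K.source := by
    rw [hK, OpenPartialHomeomorph.mem_conjModel_source, ← hy₀', hGΘ, hΘy₀]
    exact ⟨hz, hy₀G, hc⟩
  refine ⟨φ ≫ₕ K, ?_, ?_, ?_, ?_, ?_⟩
  · exact (contDiffGroupoid ∞ I).trans_mem_maximalAtlas (IsManifold.chart_mem_maximalAtlas z)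
      hKmem
  · rw [OpenPartialHomeomorph.trans_source]
    exact ⟨mem_chart_source H z, hzK⟩
  · rw [OpenPartialHomeomorph.coe_trans, comp_apply,
      OpenPartialHomeomorph.apply_conjModel_of_mem_source hzK, ← hy₀', hGΘ, hΘy₀]
  · intro q hq
    rw [OpenPartialHomeomorph.trans_source] at hq
    obtain ⟨hq₁, hq₂⟩ := hq
    rw [OpenPartialHomeomorph.coe_trans, comp_apply,
      OpenPartialHomeomorph.apply_conjModel_of_mem_source hq₂, hGΘ]
    simp only [hΘ, ContinuousLinearEquiv.symm_apply_apply, hg, comp_apply]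
    have hq₁' : q ∈ (extChartAt I z).source := by rwa [extChartAt_source]
    rw [show I (φ q) = extChartAt I z q from rfl, (extChartAt I z).left_inv hq₁']
  · intro q hq
    rw [OpenPartialHomeomorph.trans_source] at hq
    rw [OpenPartialHomeomorph.coe_trans, comp_apply]
    exact (K.map_source hq.2).1

end Straightening

end Literature.Topology.FourManifolds

end
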